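import Summits.CriticalPhenomena.SAWScalingLimit.Theorems.SAWBrickWallHomotopyModulusUniversalityBWRobustOfLipMerging
import Literature.Probability.RandomPlanarGeometry.SLEUniquenessInLaw
import HarnessLib

/-!
# `ModulusUniversality`, line `birth` (reshape 7): the three transport residues C, L, R are ONE statement modulo `HexConjecture`

Helper file (`--supports stmt-CriticalPhenomena-5790`, helper mode) of the line `birth` / `registered` for the crux
`SAWBrickWallHomotopy.ModulusUniversality` (skeleton
`Summits/CriticalPhenomena/SAWScalingLimit/Cruxes/ModulusUniversality/Lines/birth.lean`, reshape 7).

The line cuts the crux at the graph isomorphism honeycomb = brick wall `⊂ ℤ²`; its transport residue (straight brick-wall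
law with `ℤ²` conventions `≈` `B ∘` hexagonal law of `B⁻¹E`, `B = diag(2, 2/√3)`) was registered successively as

* (C) `ConventionRobustness` (registrar): weak merging of the straight brick-wall law with the jittered law
  `SAW.embLaw hexGraph (B ∘ hexCenter) E.carrier δ x_c` for SOME jittered endpoint approximation;
* (L) `JitteredLipMerging` (lead 0): the same on bounded-LIPSCHITZ test functions;
* (R) `stub_bwRobust` (lead c3, registered): GIVEN `HexConjecture`, convergence in law of the straightened brick-wall
  curves `CurveClass.map B⁻¹ ∘ curve` to chordal SLE₈⸝₃ in `B⁻¹E`.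

This file records in the tree that, GIVEN `HexConjecture` (H, the route's own rank-2 crux), C, L and R are EQUIVALENT:

* `merging_jittered_of_bwRobust` — **H ∧ R ⇒ weak merging with EVERY jittered endpoint approximation**: R gives an
  SLE₈⸝₃ random curve `Γ` of `B⁻¹E` with `map B⁻¹ ∘ curve → Γ` in law under the straight law; the exact affine transport
  (`stub_affineTransport`) makes the jittered curve integrals hexagonal ones of `f ∘ CurveClass.map B` in `B⁻¹E`, where H
  gives a second SLE₈⸝₃ random curve `Γ'`; SLE uniqueness in law (`IsSLECurve.map_eq_holds`) identifies the two limits.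
* `conventionRobustness_of_bwRobust` — **H ∧ R ⇒ C** (a jittered endpoint approximation exists,
  `exists_isEmbEndpointApprox_jittered`).
* `jitteredLipMerging_of_bwRobust` — **H ∧ R ⇒ L** (restrict C to Lipschitz test functions).
* `bwRobust_of_conventionRobustness` — **C ⇒ R** (C ⇒ L trivially, then the landed
  `stub_bwRobust_of_jitteredLipMerging : L ⇒ R`, p172453).

So planners can file the transport residue ONCE (as R).  All bookkeeping tagged [folklore]; statements are written
LITERALLY (no workfile `def`s).
-/

noncomputable section

open MeasureTheory Filter Topology
open scoped NNReal ENNReal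
open Literature.Probability.LatticeModels
open Literature.Probability.RandomPlanarGeometry

namespace Summit.CriticalPhenomena.SAWScalingLimit.Cruxes.ModulusUniversality.Birth

/-- **H ∧ R ⇒ weak merging of the straight brick-wall law with the jittered law, for EVERY jittered endpoint
approximation.**  Given `HexConjecture` and (R) `stub_bwRobust` (literal), for the affinity `B = diag(2, 2/√3)`, every
Dobrushin `E`, every `ℤ²` endpoint approximation `(a, b)` along which the straight brick-wall law is eventually a
probability measure and every jittered endpoint approximation `(a', b')` of `E`,
`∫ f(curve) dP^{BW}_{E,δ}(a,b) − ∫ f(curve) dP^{jBW}_{E,δ}(a',b') → 0` for every bounded continuous `f`.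
Proof: R gives an SLE₈⸝₃ random curve `Γ` of `B⁻¹E` with `CurveClass.map B⁻¹ ∘ curve → Γ` in law, so testing on
`f ∘ CurveClass.map B` (`curveClass_map_map_symm`) `∫ f(curve) dP^{BW} → E[f(map B ∘ Γ)]`; the affine transport
`stub_affineTransport` rewrites the jittered integral EXACTLY as the hexagonal integral of `f ∘ CurveClass.map B` in
`B⁻¹E` at a hexagonal endpoint approximation, where `HexConjecture` gives an SLE₈⸝₃ random curve `Γ'` with
`∫ f(map B ∘ curve) dP^{Hex} → E[f(map B ∘ Γ')]`; and `Γ`, `Γ'` have the same law (`IsSLECurve.map_eq_holds`, SLE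
uniqueness in law; `integral_map`), so the two limits coincide. [folklore] -/
theorem merging_jittered_of_bwRobust :
    Summit.CriticalPhenomena.SAWScalingLimit.Theses.SAWBrickWallHomotopy.HexConjecture → (Summit.CriticalPhenomena.SAWScalingLimit.Theses.SAWBrickWallHomotopy.HexConjecture → ∀ B : ℂ ≃ₜ ℂ, (∀ z : ℂ, B z = ((2 * z.re : ℝ) : ℂ) + ((2 / Real.sqrt 3 * z.im : ℝ) : ℂ) * Complex.I) → ∀ (E : DobrushinDomain) (a b : ℝ → Site 2), SAW.IsEndpointApprox E a b → (∀ᶠ δ in nhdsWithin 0 (Set.Ioi 0), IsProbabilityMeasure (SAW.brickWallLaw E.carrier δ 0 (a δ) (b δ))) → ConvergesInLawToSLE ((8 : NNReal) / 3) (E.map B.symm) (fun δ (γ : SAW.DomainSAW E.carrier δ (a δ) (b δ)) => CurveClass.map (B.symm : C(ℂ, ℂ)) γ.curve) (fun δ => SAW.brickWallLaw E.carrier δ 0 (a δ) (b δ))) → ∀ B : ℂ ≃ₜ ℂ, (∀ z : ℂ, B z = ((2 * z.re : ℝ) : ℂ) + ((2 / Real.sqrt 3 * z.im : ℝ) : ℂ)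 * Complex.I) → ∀ (E : DobrushinDomain) (a b : ℝ → Site 2), SAW.IsEndpointApprox E a b → (∀ᶠ δ in nhdsWithin 0 (Set.Ioi 0), IsProbabilityMeasure (SAW.brickWallLaw E.carrier δ 0 (a δ) (b δ))) → ∀ (a' b' : ℝ → HexVertex), SAW.IsEmbEndpointApprox hexGraph (fun v : HexVertex => B (hexCenter v)) E a' b' → ∀ f : BoundedContinuousFunction (CurveClass ℂ) ℝ, Tendsto (fun δ => (∫ γ, f γ.curve ∂(SAW.brickWallLaw E.carrier δ 0 (a δ) (b δ))) - ∫ γ, f γ.curve ∂(SAW.embLaw hexGraph (fun v : HexVertex => B (hexCenter v)) E.carrier δ SAW.hexCriticalFugacity (a' δ) (b' δ))) (nhdsWithin 0 (Set.Ioi 0)) (nhds 0) := by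
  intro hHex hR B hB E a b hab hprob a' b' habj f
  -- (R): the straightened brick-wall curves converge in law to an SLE(8/3) random curve `Γ` of `B⁻¹E`
  obtain ⟨Γ, hΓ, -, hT⟩ := hR hHex B hB E a b hab hprob
  -- (T): exact affine transport of the jittered law to the hexagonal law of `B⁻¹E`
  obtain ⟨hab', hEq⟩ := stub_affineTransport B hB E a' b' habj
  -- (H): DCS Conjecture 1 in `B⁻¹E` at the transported endpoint approximation gives a second SLE(8/3) curve `Γ'`
  obtain ⟨Γ', hΓ', -, hT'⟩ := hHex (E.map B.symm) a' b' hab'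
  -- SLE uniqueness in law
  have hlaw : (Literature.Probability.Process.preWienerMeasure).map Γ =
      (Literature.Probability.Process.preWienerMeasure).map Γ' :=
    IsSLECurve.map_eq_holds hΓ hΓ'
  -- test function `g = f ∘ CurveClass.map B`
  set g : BoundedContinuousFunction (CurveClass ℂ) ℝ :=
    f.compContinuous ⟨CurveClass.map (B : C(ℂ, ℂ)), CurveClass.continuous_map _⟩ with hg
  have hlim : (∫ ω, g (Γ ω) ∂Literature.Probability.Process.preWienerMeasure) =
      ∫ ω, g (Γ' ω) ∂Literature.Probability.Process.preWienerMeasure := by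
    rw [← integral_map hΓ.aemeasurable g.continuous.aestronglyMeasurable,
      ← integral_map hΓ'.aemeasurable g.continuous.aestronglyMeasurable, hlaw]
  have h := (hT g).sub (hT' g)
  rw [hlim, sub_self] at h
  simp only [hg, BoundedContinuousFunction.compContinuous_apply, ContinuousMap.coe_mk,
    curveClass_map_map_symm] at h
  refine h.congr fun δ => ?_
  rw [hEq δ f]

/-- **H ∧ R ⇒ C (`ConventionRobustness`, literal).**  Given `HexConjecture` and (R) `stub_bwRobust`, for
`B = diag(2, 2/√3)`, every Dobrushin `E` and every `ℤ²` endpoint approximation along which the straight brick-wall law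
is eventually a probability measure there is a jittered endpoint approximation `(a', b')` of `E` with
`∫ f(curve) dP^{BW}_{E,δ}(a,b) − ∫ f(curve) dP^{jBW}_{E,δ}(a',b') → 0` for every bounded continuous `f`: jittered
endpoint approximations exist (`exists_isEmbEndpointApprox_jittered`) and every one of them merges
(`merging_jittered_of_bwRobust`). [folklore] -/
theorem conventionRobustness_of_bwRobust :
    Summit.CriticalPhenomena.SAWScalingLimit.Theses.SAWBrickWallHomotopy.HexConjecture → (Summit.CriticalPhenomena.SAWScalingLimit.Theses.SAWBrickWallHomotopy.HexConjecture → ∀ B : ℂ ≃ₜ ℂ, (∀ z : ℂ, B z = ((2 * z.re : ℝ) : ℂ) + ((2 / Real.sqrt 3 * z.im : ℝ) : ℂ) * Complex.I) → ∀ (E : DobrushinDomain) (a b : ℝ → Site 2), SAW.IsEndpointApprox E a b → (∀ᶠ δ in nhdsWithin 0 (Set.Ioi 0), IsProbabilityMeasure (SAW.brickWallLaw E.carrier δ 0 (a δ) (b δ))) → ConvergesInLawToSLE ((8 : NNReal) / 3) (E.map B.symm) (fun δ (γ : SAW.DomainSAW E.carrier δ (a δ) (b δ)) => CurveClass.map (B.symm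 : C(ℂ, ℂ)) γ.curve) (fun δ => SAW.brickWallLaw E.carrier δ 0 (a δ) (b δ))) → ∀ B : ℂ ≃ₜ ℂ, (∀ z : ℂ, B z = ((2 * z.re : ℝ) : ℂ) + ((2 / Real.sqrt 3 * z.im : ℝ) : ℂ) * Complex.I) → ∀ (E : DobrushinDomain) (a b : ℝ → Site 2), SAW.IsEndpointApprox E a b → (∀ᶠ δ in nhdsWithin 0 (Set.Ioi 0), IsProbabilityMeasure (SAW.brickWallLaw E.carrier δ 0 (a δ) (b δ))) → ∃ a' b' : ℝ → HexVertex, SAW.IsEmbEndpointApprox hexGraph (fun v : HexVertex => B (hexCenter v)) E a' b' ∧ ∀ f : BoundedContinuousFunction (CurveClass ℂ) ℝ, Tendsto (fun δ => (∫ γ, f γ.curve ∂(SAW.brickWallLaw E.carrier δ 0 (a δ) (b δ))) - ∫ γ, f γ.curve ∂(SAW.embLaw hexGraph (fun v : HexVertex => B (hexCenter v)) E.carrier δ SAW.hexCriticalFugacity (a' δ) (b' δ))) (nhdsWithin 0 (Set.Ioi 0)) (nhds 0) := by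
  intro hHex hR B hB E a b hab hprob
  obtain ⟨a', b', hab'⟩ := exists_isEmbEndpointApprox_jittered hB E
  exact ⟨a', b', hab', merging_jittered_of_bwRobust hHex hR B hB E a b hab hprob a' b' hab'⟩

/-- **H ∧ R ⇒ L (`JitteredLipMerging`, literal).**  Given `HexConjecture` and (R) `stub_bwRobust`, the straight
brick-wall law merges with the jittered law on bounded LIPSCHITZ test functions for some jittered endpoint
approximation — the restriction of C (`conventionRobustness_of_bwRobust`) to Lipschitz `g`. [folklore] -/
theorem jitteredLipMerging_of_bwRobust :
    Summit.CriticalPhenomena.SAWScalingLimit.Theses.SAWBrickWallHomotopy.HexConjecture → (Summit.CriticalPhenomena.SAWScalingLimit.Theses.SAWBrickWallHomotopy.HexConjecture → ∀ B : ℂ ≃ₜ ℂ, (∀ z : ℂ, B z = ((2 * z.re : ℝ) : ℂ) + ((2 / Real.sqrt 3 * z.im : ℝ) : ℂ) * Complex.I) → ∀ (E : DobrushinDomain) (a b : ℝ → Site 2), SAW.IsEndpointApprox E a b → (∀ᶠ δ in nhdsWithin 0 (Set.Ioi 0), IsProbabilityMeasure (SAW.brickWallLaw E.carrier δ 0 (a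 δ) (b δ))) → ConvergesInLawToSLE ((8 : NNReal) / 3) (E.map B.symm) (fun δ (γ : SAW.DomainSAW E.carrier δ (a δ) (b δ)) => CurveClass.map (B.symm : C(ℂ, ℂ)) γ.curve) (fun δ => SAW.brickWallLaw E.carrier δ 0 (a δ) (b δ))) → ∀ B : ℂ ≃ₜ ℂ, (∀ z : ℂ, B z = ((2 * z.re : ℝ) : ℂ) + ((2 / Real.sqrt 3 * z.im : ℝ) : ℂ) * Complex.I) → ∀ (E : DobrushinDomain) (a b : ℝ → Site 2), SAW.IsEndpointApprox E a b → (∀ᶠ δ in nhdsWithin 0 (Set.Ioi 0), IsProbabilityMeasure (SAW.brickWallLaw E.carrier δ 0 (a δ) (b δ))) → ∃ a' b' : ℝ → HexVertex, SAW.IsEmbEndpointApprox hexGraph (fun v : HexVertex => B (hexCenter v)) E a' b' ∧ ∀ (g : BoundedContinuousFunction (CurveClass ℂ) ℝ) (L : NNReal), LipschitzWith L g → Tendsto (fun δ => (∫ γ, g γ.curve ∂(SAW.brickWallLaw E.carrier δ 0 (a δ) (b δ))) - ∫ γ, g γ.curve ∂(SAW.embLaw hexGraph (fun v : HexVertex =>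 B (hexCenter v)) E.carrier δ SAW.hexCriticalFugacity (a' δ) (b' δ))) (nhdsWithin 0 (Set.Ioi 0)) (nhds 0) := by
  intro hHex hR B hB E a b hab hprob
  obtain ⟨a', b', hab', h⟩ := conventionRobustness_of_bwRobust hHex hR B hB E a b hab hprob
  exact ⟨a', b', hab', fun g _ _ => h g⟩

/-- **C ⇒ R (`ConventionRobustness` implies `stub_bwRobust`, both literal).**  Weak merging with the jittered law for
some jittered endpoint approximation (C) restricts to bounded-Lipschitz merging (L), and L ⇒ R is the landed glue stub
`stub_bwRobust_of_jitteredLipMerging` (p172453: affine transport + `HexConjecture` in `B⁻¹E` + the bounded-Lipschitz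
portmanteau upgrade).  With `conventionRobustness_of_bwRobust` and `jitteredLipMerging_of_bwRobust`: given
`HexConjecture`, C ⇔ L ⇔ R. [folklore] -/
theorem bwRobust_of_conventionRobustness :
    (∀ B : ℂ ≃ₜ ℂ, (∀ z : ℂ, B z = ((2 * z.re : ℝ) : ℂ) + ((2 / Real.sqrt 3 * z.im : ℝ) : ℂ) * Complex.I) → ∀ (E : DobrushinDomain) (a b : ℝ → Site 2), SAW.IsEndpointApprox E a b → (∀ᶠ δ in nhdsWithin 0 (Set.Ioi 0), IsProbabilityMeasure (SAW.brickWallLaw E.carrier δ 0 (a δ) (b δ))) → ∃ a' b' : ℝ → HexVertex, SAW.IsEmbEndpointApprox hexGraph (fun v : HexVertex => B (hexCenter v)) E a' b' ∧ ∀ f : BoundedContinuousFunction (CurveClass ℂ) ℝ, Tendsto (fun δ => (∫ γ, f γ.curve ∂(SAW.brickWallLaw E.carrier δ 0 (a δ) (b δ))) - ∫ γ, f γ.curve ∂(SAW.embLaw hexGraph (fun v : HexVertex => B (hexCenter v)) E.carrier δ SAW.hexCriticalFugacity (a' δ) (b' δ))) (nhdsWithin 0 (Set.Ioi 0)) (nhds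 0)) → Summit.CriticalPhenomena.SAWScalingLimit.Theses.SAWBrickWallHomotopy.HexConjecture → ∀ B : ℂ ≃ₜ ℂ, (∀ z : ℂ, B z = ((2 * z.re : ℝ) : ℂ) + ((2 / Real.sqrt 3 * z.im : ℝ) : ℂ) * Complex.I) → ∀ (E : DobrushinDomain) (a b : ℝ → Site 2), SAW.IsEndpointApprox E a b → (∀ᶠ δ in nhdsWithin 0 (Set.Ioi 0), IsProbabilityMeasure (SAW.brickWallLaw E.carrier δ 0 (a δ) (b δ))) → ConvergesInLawToSLE ((8 : NNReal) / 3) (E.map B.symm) (fun δ (γ : SAW.DomainSAW E.carrier δ (a δ) (b δ)) => CurveClass.map (B.symm : C(ℂ, ℂ)) γ.curve) (fun δ => SAW.brickWallLaw E.carrier δ 0 (a δ) (b δ)) := by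
  intro hC
  refine stub_bwRobust_of_jitteredLipMerging ?_
  intro B hB E a b hab hprob
  obtain ⟨a', b', hab', h⟩ := hC B hB E a b hab hprob
  exact ⟨a', b', hab', fun g _ _ => h g⟩

end Summit.CriticalPhenomena.SAWScalingLimit.Cruxes.ModulusUniversality.Birth

end
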